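import Summits.PneNP.PneNP.Theorems.ChebyshevTracialDesignRectangleBiMode
import Summits.PneNP.PneNP.Theorems.ChebyshevTracialDesignJuntaPatternLaw
import HarnessLib

/-!
# Cell pnp-psdrank, route `ChebyshevTracialDesign`: the bi-mode coefficient of a level class is a finite DIFFERENCE of
# the reduced level law (closed form of (★), every level)

Harmonic backbone of the crux `TracialDecayExp20` (stmt-PneNP-19878), brick 10. Brick 7 (`…LevelColumnSums`, (★)) gives the
coefficient `σ̃_{2κ}(e₀)` with which the layer `2κ` of a family of `(2l+1)`-cuts enters the count on the level class "`e₀` inner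
edges" (`cc = 2l+1−2e₀`) of a perfect matching, as an ALTERNATING sum of binomial moments. Here it is evaluated in closed form:
with `N = n/2` and the level law `T(N'; c', e') = C(N', c'+e')·C(c'+e', e')·2^{c'}` of the REDUCED instance `N' = N−2κ` (the number
of `(2(l−κ)+1)`-subsets of a `2N'`-set meeting a fixed perfect matching in `e'` inner and `c' = 2(l−κ)+1−2e'` crossing edges),
  `σ̃_{2κ}(e₀) = Σ_{e' ≤ l−κ, e' ≤ e₀} (−1)^{κ−(e₀−e')} C(κ, e₀−e') · T(N−2κ; 2(l−κ)+1−2e', e')`     (`bimodeCoeff_eq_difference`)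
— the `κ`-th backward difference, in the number of inner edges, of the level law of the instance with `2κ` FEWER edges.
Ingredients (elementary): `Σ_{2b ≤ s} T(μ; s−2b, b) = C(2μ, s)` (`sum_levelLaw_eq_choose`, by the recursion `T_succ` of
`…JuntaCount`), the binomial moments `Σ_{e'} C(e',a')·T(N'; t'−2e', e') = C(N',a')·C(2N'−2a', t'−2a')` (`sum_choose_mul_levelLaw`),
and the iterated forward difference of `x ↦ C(x, r)` (Mathlib `fwdDiff_iter_choose`). Restated in the vocabulary of bricks 7–8:
`level_column_sum_zeta_eq_difference`, `card_filter_level_eq_difference`. At the tight level `e₀ = l` only `e' = l−κ` survives: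
`(n − 2l − 2κ)·C(N−2κ, l−κ)` (brick 5a). [cite: Rothvoss2017, §2 (PDF p. 6)] [cite: GodsilMeagher2015, §15.2 (perfect matching scheme)]
Stature: support/instrument. WHAT THIS IS NOT: no inequality yet, nothing on psd rank, no P-vs-NP content. Supports stmt-PneNP-19878.
-/

set_option linter.dupNamespace false -- `Summit.PneNP.PneNP.…`: summit = sub-problem (D-0017)

noncomputable section

namespace Summit.PneNP.PneNP.Theorems.ChebyshevTracialDesignLevelDifference

open Finset Literature.Combinatorics.AssociationSchemes Literature.Combinatorics.AssociationSchemes.JohnsonHarmonics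
open Summit.PneNP.PneNP.Theorems.ChebyshevTracialDesignJunta
open Summit.PneNP.PneNP.Theorems.ChebyshevTracialDesignLevelColumnSums
open Summit.PneNP.PneNP.Theorems.ChebyshevTracialDesignRectangleBiMode
open Summit.PneNP.PneNP.Theorems.ChebyshevTracialDesignInvolutionKeys
open scoped fwdDiff

variable {n : ℕ}

/-! ### §1 The level law `T(μ; a, b) = C(μ, a+b)·C(a+b, b)·2^a` sums to the binomial coefficient -/

/-- **`Σ_{2b ≤ s} T(μ; s−2b, b) = C(2μ, s)`**: the `s`-subsets of a `2μ`-set classified by the number `b` of inner edges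
of a fixed perfect matching (`s − 2b` crossing edges, two endpoint choices each). Proof by the recursion `T_succ`. [folklore] -/
theorem sum_levelLaw_eq_choose (μ : ℕ) : ∀ s : ℕ,
    ∑ b ∈ range (s + 1), (if 2 * b ≤ s then
        μ.choose (s - 2 * b + b) * (s - 2 * b + b).choose b * 2 ^ (s - 2 * b) else 0) = (2 * μ).choose s := by
  induction μ with
  | zero =>
    intro s
    rcases s with _ | s
    · simp
    · rw [Nat.mul_zero, Nat.choose_zero_succ]
      refine sum_eq_zero fun b hb => ?_
      have hb' := mem_range.1 hb
      split_ifs with h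
      · rw [Nat.choose_eq_zero_of_lt (by omega : 0 < s + 1 - 2 * b + b)]; simp
      · rfl
  | succ μ ih =>
    intro s
    -- expand every term by `T_succ`
    have hterm : ∀ b ∈ range (s + 1), (if 2 * b ≤ s then
        (μ + 1).choose (s - 2 * b + b) * (s - 2 * b + b).choose b * 2 ^ (s - 2 * b) else 0) =
        (if 2 * b ≤ s then μ.choose (s - 2 * b + b) * (s - 2 * b + b).choose b * 2 ^ (s - 2 * b) else 0) +
        ((if 2 * b + 1 ≤ s then
            2 * (μ.choose (s - 2 * b - 1 + b) * (s - 2 * b - 1 + b).choose b * 2 ^ (s - 2 * b - 1)) else 0) +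
          (if 2 * b ≤ s ∧ 1 ≤ b then
            μ.choose (s - 2 * b + (b - 1)) * (s - 2 * b + (b - 1)).choose (b - 1) * 2 ^ (s - 2 * b) else 0)) := by
      intro b _
      by_cases h : 2 * b ≤ s
      · rw [T_succ μ (s - 2 * b) b]
        have hc1 : (1 ≤ s - 2 * b) ↔ (2 * b + 1 ≤ s) := by omega
        simp [h, hc1, add_assoc]
      · have h' : ¬ (2 * b + 1 ≤ s) := by omega
        simp [h, h']
    rw [sum_congr rfl hterm, sum_add_distrib, sum_add_distrib, ih s]
    -- the crossing term: `2·C(2μ, s−1)`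
    have hcross : ∑ b ∈ range (s + 1), (if 2 * b + 1 ≤ s then
        2 * (μ.choose (s - 2 * b - 1 + b) * (s - 2 * b - 1 + b).choose b * 2 ^ (s - 2 * b - 1)) else 0) =
        if 1 ≤ s then 2 * (2 * μ).choose (s - 1) else 0 := by
      rcases s with _ | s
      · simp
      · rw [if_pos (by omega), Nat.add_sub_cancel, ← ih s, mul_sum]
        conv_lhs => rw [sum_range_succ]
        rw [if_neg (by omega), add_zero]
        refine sum_congr rfl fun b _ => ?_
        by_cases h : 2 * b ≤ s
        · rw [if_pos (by omega), if_pos h, show s + 1 - 2 * b - 1 = s - 2 * b by omega]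
        · rw [if_neg (by omega), if_neg h, mul_zero]
    -- the inner term: `C(2μ, s−2)`
    have hinner : ∑ b ∈ range (s + 1), (if 2 * b ≤ s ∧ 1 ≤ b then
        μ.choose (s - 2 * b + (b - 1)) * (s - 2 * b + (b - 1)).choose (b - 1) * 2 ^ (s - 2 * b) else 0) =
        if 2 ≤ s then (2 * μ).choose (s - 2) else 0 := by
      rcases s with _ | _ | s
      · simp
      · rw [if_neg (by omega)]
        refine sum_eq_zero fun b _ => ?_
        rw [if_neg (by omega)]
      · rw [if_pos (by omega), show s + 1 + 1 - 2 = s by omega, ← ih s, sum_range_succ',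
          if_neg (by omega), add_zero]
        conv_lhs => rw [sum_range_succ]
        rw [if_neg (by omega), add_zero]
        refine sum_congr rfl fun b _ => ?_
        by_cases h : 2 * b ≤ s
        · rw [if_pos (show 2 * (b + 1) ≤ s + 1 + 1 ∧ 1 ≤ b + 1 from ⟨by omega, by omega⟩), if_pos h,
            Nat.add_sub_cancel, show s + 1 + 1 - 2 * (b + 1) = s - 2 * b by omega]
        · rw [if_neg (by omega), if_neg h]
    rw [hcross, hinner]
    -- Pascal twice: `C(2μ+2, s) = C(2μ, s) + 2·C(2μ, s−1) + C(2μ, s−2)`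
    rw [show 2 * (μ + 1) = 2 * μ + 1 + 1 by ring]
    rcases s with _ | _ | s
    · simp
    · rw [if_pos le_rfl, if_neg (by omega)]
      simp
    · rw [if_pos (by omega), if_pos (by omega), show s + 1 + 1 - 1 = s + 1 by omega, show s + 1 + 1 - 2 = s by omega,
        Nat.choose_succ_succ (2 * μ + 1) (s + 1), Nat.choose_succ_succ (2 * μ) (s + 1), Nat.choose_succ_succ (2 * μ) s]
      ring

/-! ### §2 Binomial moments of the level law -/

/-- Rearrangement `C(e', a')·T(N'; c', e') = C(N', a')·T(N'−a'; c', e'−a')` for `a' ≤ e'` (choose the `a'` marked inner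
edges first). [folklore] -/
theorem choose_mul_levelLaw (N' c' e' a' : ℕ) (ha : a' ≤ e') :
    e'.choose a' * (N'.choose (c' + e') * (c' + e').choose e' * 2 ^ c') =
      N'.choose a' * ((N' - a').choose (c' + (e' - a')) * (c' + (e' - a')).choose (e' - a') * 2 ^ c') := by
  have h1 := Nat.choose_mul (n := c' + e') (k := e') (s := a') ha
  have h2 := Nat.choose_mul (n := N') (k := c' + e') (s := a') (by omega)
  have e1 : c' + e' - a' = c' + (e' - a') := by omega
  rw [e1] at h1 h2
  calc e'.choose a' * (N'.choose (c' + e') * (c' + e').choose e' * 2 ^ c')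
      = N'.choose (c' + e') * ((c' + e').choose e' * e'.choose a') * 2 ^ c' := by ring
    _ = N'.choose (c' + e') * ((c' + e').choose a' * (c' + (e' - a')).choose (e' - a')) * 2 ^ c' := by rw [h1]
    _ = (N'.choose (c' + e') * (c' + e').choose a') * (c' + (e' - a')).choose (e' - a') * 2 ^ c' := by ring
    _ = _ := by rw [h2]; ring

/-- **Binomial moments of the level law**: for `a' ≤ l'` and `t' = 2l'+1`,
`Σ_{e' ≤ l'} C(e', a') · T(N'; t'−2e', e') = C(N', a') · C(2N'−2a', t'−2a')`
(the pairs (`a'` marked inner edges ⊆ a `t'`-set), counted in two ways). [folklore] -/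
theorem sum_choose_mul_levelLaw (N' l' a' : ℕ) (ha : a' ≤ l') :
    ∑ e' ∈ range (l' + 1), e'.choose a' *
        (N'.choose (2 * l' + 1 - 2 * e' + e') * (2 * l' + 1 - 2 * e' + e').choose e' * 2 ^ (2 * l' + 1 - 2 * e')) =
      N'.choose a' * (2 * (N' - a')).choose (2 * l' + 1 - 2 * a') := by
  -- terms `e' < a'` vanish; for `e' ≥ a'` rearrange and shift `e' = a' + b`
  rw [← sum_range_add_sum_Ico _ (show a' ≤ l' + 1 by omega)]
  have h0 : ∑ e' ∈ range a', e'.choose a' *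
      (N'.choose (2 * l' + 1 - 2 * e' + e') * (2 * l' + 1 - 2 * e' + e').choose e' * 2 ^ (2 * l' + 1 - 2 * e')) = 0 :=
    sum_eq_zero fun e' he' => by rw [Nat.choose_eq_zero_of_lt (mem_range.1 he'), zero_mul]
  rw [h0, zero_add, sum_Ico_eq_sum_range, show l' + 1 - a' = l' - a' + 1 by omega,
    show 2 * l' + 1 - 2 * a' = 2 * (l' - a') + 1 by omega, ← sum_levelLaw_eq_choose (N' - a') (2 * (l' - a') + 1),
    ← sum_range_add_sum_Ico _ (show l' - a' + 1 ≤ 2 * (l' - a') + 1 + 1 by omega)]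
  -- the reduced sum has vanishing terms beyond `b = l' − a'`
  have h1 : ∑ b ∈ Ico (l' - a' + 1) (2 * (l' - a') + 1 + 1), (if 2 * b ≤ 2 * (l' - a') + 1 then
      (N' - a').choose (2 * (l' - a') + 1 - 2 * b + b) * (2 * (l' - a') + 1 - 2 * b + b).choose b *
        2 ^ (2 * (l' - a') + 1 - 2 * b) else 0) = 0 :=
    sum_eq_zero fun b hb => by rw [if_neg (by have := (mem_Ico.1 hb).1; omega)]
  rw [h1, add_zero, mul_sum]
  refine sum_congr rfl fun b hb => ?_
  have hb' := mem_range.1 hb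
  rw [if_pos (by omega), choose_mul_levelLaw N' _ _ _ (Nat.le_add_right a' b), Nat.add_sub_cancel_left,
    show 2 * l' + 1 - 2 * (a' + b) = 2 * (l' - a') + 1 - 2 * b by omega]

/-- The binomial-moment identity over `ℝ`, the level law kept as one natural number. [folklore] -/
theorem sum_choose_mul_levelLaw_real (N' l' a' : ℕ) (ha : a' ≤ l') :
    ∑ e' ∈ range (l' + 1), (e'.choose a' : ℝ) *
        ((N'.choose (2 * l' + 1 - 2 * e' + e') * (2 * l' + 1 - 2 * e' + e').choose e' * 2 ^ (2 * l' + 1 - 2 * e') : ℕ) : ℝ) =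
      ((N'.choose a' * (2 * (N' - a')).choose (2 * l' + 1 - 2 * a') : ℕ) : ℝ) := by
  rw [← sum_choose_mul_levelLaw N' l' a' ha, Nat.cast_sum]
  refine sum_congr rfl fun e' _ => ?_
  push_cast
  ring

/-! ### §3 Iterated differences of `x ↦ C(x, r)` -/

/-- `Σ_{a < L} (−1)^a C(m, a) C(x + a, r) = (−1)^m C(x, r − m)` for `m ≤ r`, and `= 0` for `r < m` (`m < L`): the `m`-th
forward difference of `x ↦ C(x, r)`, a polynomial of degree `r` (Newton's formula, Mathlib `fwdDiff_iter_eq_sum_shift`,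
and `fwdDiff_iter_choose`). [folklore] -/
theorem alternating_sum_choose_mul_choose_add (m x r L : ℕ) (hmL : m < L) :
    ∑ a ∈ range L, (-1 : ℝ) ^ a * (m.choose a : ℝ) * ((x + a).choose r : ℝ) =
      if m ≤ r then (-1 : ℝ) ^ m * (x.choose (r - m) : ℝ) else 0 := by
  rw [← sum_subset (range_subset_range.2 (show m + 1 ≤ L by omega)) (fun a _ ha => by  -- terms `a > m` vanish
    rw [mem_range, not_lt] at ha; rw [Nat.choose_eq_zero_of_lt (by omega : m < a)]; simp)]
  -- Newton's formula for the iterated forward difference, over `ℤ`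
  have key := fwdDiff_iter_eq_sum_shift (1 : ℕ) (fun y : ℕ => ((y.choose r : ℕ) : ℤ)) m x
  simp only [smul_eq_mul, mul_one] at key
  have h2 : (fwdDiff (1 : ℕ))^[r + 1] (fun y : ℕ => ((y.choose r : ℕ) : ℤ)) = fun _ => 0 := by
    have h := fwdDiff_iter_choose 0 r
    rw [Nat.add_zero] at h
    rw [Function.iterate_succ_apply', h]
    simp only [Nat.choose_zero_right, Nat.cast_one]
    exact fwdDiff_const 1 (1 : ℤ)
  have hval : (fwdDiff (1 : ℕ))^[m] (fun y : ℕ => ((y.choose r : ℕ) : ℤ)) x =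
      if m ≤ r then ((x.choose (r - m) : ℕ) : ℤ) else 0 := by
    split_ifs with hmr
    · have h := fwdDiff_iter_choose (r - m) m
      rw [show m + (r - m) = r by omega] at h
      rw [h]
    · obtain ⟨d, hd⟩ : ∃ d, m = d + (r + 1) := ⟨m - (r + 1), by omega⟩  -- `Δ^[m] = Δ^[m−r−1] ∘ Δ^[r+1] = 0`
      rw [hd, Function.iterate_add_apply, h2, Function.iterate_fixed (fwdDiff_const (1 : ℕ) (0 : ℤ)) d]
  -- compare signs: `(−1)^{m−a} · (−1)^m = (−1)^a` for `a ≤ m`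
  have hZ : ∑ a ∈ range (m + 1), (-1 : ℤ) ^ a * (m.choose a : ℤ) * (((x + a).choose r : ℕ) : ℤ) =
      (-1 : ℤ) ^ m * (if m ≤ r then ((x.choose (r - m) : ℕ) : ℤ) else 0) := by
    rw [← hval, key, mul_sum]
    refine sum_congr rfl fun a ha => ?_
    have ham : a ≤ m := by have := mem_range.1 ha; omega
    have hsign : (-1 : ℤ) ^ a = (-1 : ℤ) ^ m * (-1 : ℤ) ^ (m - a) := by
      rw [← pow_add, show m + (m - a) = a + 2 * (m - a) by omega, pow_add, pow_mul]; simp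
    rw [hsign]; ring
  have hR := congrArg (fun z : ℤ => (z : ℝ)) hZ
  push_cast at hR
  rw [hR]; split_ifs <;> simp

/-! ### §4 The bi-mode coefficient as a difference of the reduced level law -/

/-- Descending products as binomial coefficients: `(Π_{i<s} (m − i)) / s! = C(m, s)` in `ℝ` (both sides vanish for
`s > m`). [folklore] -/
theorem prod_sub_div_factorial_eq_choose (m s : ℕ) :
    (∏ i ∈ range s, ((m : ℝ) - i)) / (s.factorial : ℝ) = (m.choose s : ℝ) := by
  have hs : (s.factorial : ℝ) ≠ 0 := by positivity
  rw [div_eq_iff hs]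
  by_cases hsm : s ≤ m
  · rw [← cast_descFactorial_eq_prod hsm, Nat.descFactorial_eq_factorial_mul_choose]; push_cast; ring
  · push Not at hsm
    rw [Nat.choose_eq_zero_of_lt hsm, Nat.cast_zero, zero_mul]
    exact prod_eq_zero (mem_range.2 hsm) (sub_self _)

/-- **The bi-mode coefficient is a difference of the reduced level law** (pure arithmetic form). For `κ ≤ l` and
`2l + 1 ≤ N` (cuts of size `t = 2l+1 ≤ n/2`, `n = 2N`; any `e₀`), the coefficient (★) of `…LevelColumnSums` /
`…RectangleBiMode` equals
`Σ_{e' ≤ l−κ} [e' ≤ e₀] (−1)^{κ−(e₀−e')} C(κ, e₀−e') · T(N−2κ; 2(l−κ)+1−2e', e')`. [cite: Rothvoss2017, §2 (PDF p. 6)] -/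
theorem bimodeCoeff_eq_difference (N l κ e₀ : ℕ) (hκl : κ ≤ l) (hlN : 2 * l + 1 ≤ N) :
    (∑ a ∈ range (l + 1), if e₀ ≤ a ∧ κ ≤ a then
        (-1 : ℝ) ^ (a - e₀) * (a.choose e₀ : ℝ) *
          ((∏ i ∈ range (2 * l + 1 - 2 * a), (((2 * N : ℕ) : ℝ) - (2 * a : ℕ) - (2 * κ : ℕ) - i)) /
            ((2 * l + 1 - 2 * a).factorial : ℝ)) *
          (((N - 2 * κ).choose (a - κ) : ℕ) : ℝ)
      else 0) =
      ∑ e' ∈ range (l - κ + 1), if e' ≤ e₀ then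
        (-1 : ℝ) ^ (κ - (e₀ - e')) * (κ.choose (e₀ - e') : ℝ) *
          (((N - 2 * κ).choose (2 * (l - κ) + 1 - 2 * e' + e') *
              (2 * (l - κ) + 1 - 2 * e' + e').choose e' * 2 ^ (2 * (l - κ) + 1 - 2 * e') : ℕ) : ℝ)
      else 0 := by
  set N' := N - 2 * κ with hN'
  set l' := l - κ with hl'
  -- Step 1: the `a`-terms below `κ` vanish; shift `a = κ + a'` and write the product as a binomial coefficient
  have hstep1 : (∑ a ∈ range (l + 1), if e₀ ≤ a ∧ κ ≤ a then
        (-1 : ℝ) ^ (a - e₀) * (a.choose e₀ : ℝ) *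
          ((∏ i ∈ range (2 * l + 1 - 2 * a), (((2 * N : ℕ) : ℝ) - (2 * a : ℕ) - (2 * κ : ℕ) - i)) /
            ((2 * l + 1 - 2 * a).factorial : ℝ)) * ((N'.choose (a - κ) : ℕ) : ℝ) else 0) =
      ∑ a' ∈ range (l' + 1), (-1 : ℝ) ^ (κ + e₀) * ((-1 : ℝ) ^ a' * ((κ + a').choose e₀ : ℝ) *
          ((N'.choose a' * (2 * (N' - a')).choose (2 * l' + 1 - 2 * a') : ℕ) : ℝ)) := by
    rw [← sum_range_add_sum_Ico _ (show κ ≤ l + 1 by omega)]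
    have h0 : ∑ a ∈ range κ, (if e₀ ≤ a ∧ κ ≤ a then
        (-1 : ℝ) ^ (a - e₀) * (a.choose e₀ : ℝ) *
          ((∏ i ∈ range (2 * l + 1 - 2 * a), (((2 * N : ℕ) : ℝ) - (2 * a : ℕ) - (2 * κ : ℕ) - i)) /
            ((2 * l + 1 - 2 * a).factorial : ℝ)) * ((N'.choose (a - κ) : ℕ) : ℝ) else 0) = 0 :=
      sum_eq_zero fun a ha => by rw [if_neg (fun h => by have := mem_range.1 ha; omega)]
    rw [h0, zero_add, sum_Ico_eq_sum_range, show l + 1 - κ = l' + 1 by omega]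
    refine sum_congr rfl fun a' ha' => ?_
    have ha'l : a' ≤ l' := by have := mem_range.1 ha'; omega
    -- the product is a binomial coefficient: `n − 2(κ+a') − 2κ = 2(N' − a')`
    have hcast : ((2 * (N' - a') : ℕ) : ℝ) = ((2 * N : ℕ) : ℝ) - (2 * (κ + a') : ℕ) - (2 * κ : ℕ) := by
      rw [hN']
      push_cast [Nat.cast_sub (show 2 * κ ≤ N by omega), Nat.cast_sub (show a' ≤ N - 2 * κ by omega)]
      ring
    have hprod : (∏ i ∈ range (2 * l + 1 - 2 * (κ + a')), (((2 * N : ℕ) : ℝ) - (2 * (κ + a') : ℕ) - (2 * κ : ℕ) - i)) /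
        ((2 * l + 1 - 2 * (κ + a')).factorial : ℝ) = (((2 * (N' - a')).choose (2 * l' + 1 - 2 * a') : ℕ) : ℝ) := by
      rw [show 2 * l + 1 - 2 * (κ + a') = 2 * l' + 1 - 2 * a' by omega, ← prod_sub_div_factorial_eq_choose, hcast]
    by_cases hea : e₀ ≤ κ + a'
    · rw [if_pos ⟨hea, Nat.le_add_right κ a'⟩, hprod, Nat.add_sub_cancel_left]
      have hsign : (-1 : ℝ) ^ (κ + a' - e₀) = (-1 : ℝ) ^ (κ + e₀) * (-1 : ℝ) ^ a' := by
        rw [← pow_add, show κ + e₀ + a' = (κ + a' - e₀) + 2 * e₀ by omega, pow_add, pow_mul]; simp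
      rw [hsign]; push_cast; ring
    · rw [if_neg (fun h => hea h.1), Nat.choose_eq_zero_of_lt (by omega : κ + a' < e₀)]; simp
  rw [hstep1]
  -- Step 2: binomial moments of the reduced level law and exchange of the two sums
  have hstep2 : ∀ a' ∈ range (l' + 1), (-1 : ℝ) ^ (κ + e₀) * ((-1 : ℝ) ^ a' * ((κ + a').choose e₀ : ℝ) *
      ((N'.choose a' * (2 * (N' - a')).choose (2 * l' + 1 - 2 * a') : ℕ) : ℝ)) =
      ∑ e' ∈ range (l' + 1), (-1 : ℝ) ^ (κ + e₀) *
        ((N'.choose (2 * l' + 1 - 2 * e' + e') * (2 * l' + 1 - 2 * e' + e').choose e' * 2 ^ (2 * l' + 1 - 2 * e') : ℕ) : ℝ) *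
        ((-1 : ℝ) ^ a' * (e'.choose a' : ℝ) * ((κ + a').choose e₀ : ℝ)) := by
    intro a' ha'
    have ha'l : a' ≤ l' := by have := mem_range.1 ha'; omega
    rw [← sum_choose_mul_levelLaw_real N' l' a' ha'l, mul_sum, mul_sum]
    refine sum_congr rfl fun e' _ => ?_
    ring
  rw [sum_congr rfl hstep2, sum_comm]
  -- Step 3: the inner alternating sum is an iterated difference of `x ↦ C(x, e₀)` at `κ`
  have hstep3 : ∀ e' ∈ range (l' + 1), ∑ a' ∈ range (l' + 1), (-1 : ℝ) ^ (κ + e₀) *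
      ((N'.choose (2 * l' + 1 - 2 * e' + e') * (2 * l' + 1 - 2 * e' + e').choose e' * 2 ^ (2 * l' + 1 - 2 * e') : ℕ) : ℝ) *
        ((-1 : ℝ) ^ a' * (e'.choose a' : ℝ) * ((κ + a').choose e₀ : ℝ)) =
      if e' ≤ e₀ then (-1 : ℝ) ^ (κ + e₀) * (-1 : ℝ) ^ e' * (κ.choose (e₀ - e') : ℝ) *
        ((N'.choose (2 * l' + 1 - 2 * e' + e') * (2 * l' + 1 - 2 * e' + e').choose e' * 2 ^ (2 * l' + 1 - 2 * e') : ℕ) : ℝ)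
      else 0 := by
    intro e' he'
    have he'l : e' < l' + 1 := mem_range.1 he'
    rw [← mul_sum, alternating_sum_choose_mul_choose_add e' κ e₀ (l' + 1) he'l]
    split_ifs <;> ring
  rw [sum_congr rfl hstep3]
  -- Step 4: the signs `(−1)^{κ+e₀+e'} = (−1)^{κ−(e₀−e')}` (when `C(κ, e₀−e') ≠ 0`)
  refine sum_congr rfl fun e' _ => ?_
  by_cases h : e' ≤ e₀
  · rw [if_pos h, if_pos h]
    by_cases hk : e₀ - e' ≤ κ
    · have hsign : (-1 : ℝ) ^ (κ + e₀) * (-1 : ℝ) ^ e' = (-1 : ℝ) ^ (κ - (e₀ - e')) := by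
        rw [← pow_add, show κ + e₀ + e' = (κ - (e₀ - e')) + 2 * e₀ by omega, pow_add, pow_mul]; simp
      rw [hsign]
    · rw [Nat.choose_eq_zero_of_lt (by omega : κ < e₀ - e')]; simp
  · rw [if_neg h, if_neg h]

/-! ### §5 In the vocabulary of bricks 7–8: column sums and the bi-mode expansion with the closed-form coefficient -/

section Invol

variable {π : Fin n → Fin n} (hinv : ∀ x, π (π x) = x) (hfix : ∀ x, π x ≠ x)
include hinv hfix

/-- **Column sums of an even harmonic layer over a level class, closed form.** For `π` a fixed-point-free involution of
`Fin n` (`n = 2N`), `p` harmonic of degree `2κ`, cuts of size `2l+1` with `κ ≤ l`, `2(2l+1) ≤ n`, and any level class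
`e_π(U) = e₀`: `Σ_{|U| = 2l+1, e_π(U) = e₀} zeta p (U) = σ̃ · Σ_{T closed, |T| = 2κ} p_T` with
`σ̃ = Σ_{e' ≤ l−κ, e' ≤ e₀} (−1)^{κ−(e₀−e')} C(κ, e₀−e')·T(N−2κ; 2(l−κ)+1−2e', e')`. [cite: Rothvoss2017, §2 (PDF p. 6)] -/
theorem level_column_sum_zeta_eq_difference {κ l e₀ : ℕ} (hκl : κ ≤ l) (hl : 2 * (2 * l + 1) ≤ n)
    {p : Finset (Fin n) → ℝ} (hp : IsHarmonic (2 * κ) p) :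
    ∑ U ∈ (powersetCard (2 * l + 1) (univ : Finset (Fin n))).filter
        (fun U => (U.filter fun x => x < π x ∧ π x ∈ U).card = e₀), zeta p U =
      (∑ e' ∈ range (l - κ + 1), if e' ≤ e₀ then
        (-1 : ℝ) ^ (κ - (e₀ - e')) * (κ.choose (e₀ - e') : ℝ) *
          (((n / 2 - 2 * κ).choose (2 * (l - κ) + 1 - 2 * e' + e') *
              (2 * (l - κ) + 1 - 2 * e' + e').choose e' * 2 ^ (2 * (l - κ) + 1 - 2 * e') : ℕ) : ℝ)
        else 0) *
        ∑ T ∈ univ.filter (fun T : Finset (Fin n) => (T.filter fun x => π x ∈ T).card = 2 * κ), p T := by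
  have hkeys := two_mul_card_keys hinv hfix
  have hN : ((univ : Finset (Fin n)).filter fun x => x < π x).card = n / 2 := by omega
  have hn : n = 2 * (n / 2) := by omega
  rw [level_column_sum_zeta_eq_of_even hinv hfix (by omega) hp l e₀, hN]
  congr 1
  have h := bimodeCoeff_eq_difference (n / 2) l κ e₀ hκl (by omega)
  rw [← hn] at h
  exact h

end Invol

/-- **The bi-mode expansion with the closed-form coefficient** (brick 8 restated). For a family `X` of `(2l+1)`-cuts with
`2(2l+1) ≤ n` there are harmonic `p_j` with `1[U ∈ X] = Σ_j (2l+1−j)!·zeta p_j (U)` on the `(2l+1)`-sets such that for EVERY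
fixed-point-free involution `π` of `Fin n` and EVERY level `e₀`, `#{U ∈ X : e_π(U) = e₀}` is the sum over the even
layers `2κ ≤ 2l` of `(2l+1−2κ)! · σ̃_{2κ}(e₀) · Π_{p_{2κ}}(π)` with
`σ̃_{2κ}(e₀) = Σ_{e' ≤ l−κ, e' ≤ e₀} (−1)^{κ−(e₀−e')} C(κ, e₀−e')·T(n/2−2κ; 2(l−κ)+1−2e', e')` and
`Π_p(π) = Σ_{T π-closed, |T| = 2κ} p_T`. [cite: Rothvoss2017, §2 (PDF p. 6)] [cite: GodsilMeagher2015, §15.2 (perfect matching scheme)] -/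
theorem card_filter_level_eq_difference {l : ℕ} (hl : 2 * (2 * l + 1) ≤ n) (X : Finset (Finset (Fin n)))
    (hX : X ⊆ powersetCard (2 * l + 1) (univ : Finset (Fin n))) :
    ∃ p : ℕ → (Finset (Fin n) → ℝ), (∀ j, IsHarmonic j (p j)) ∧
      (∀ U ∈ powersetCard (2 * l + 1) (univ : Finset (Fin n)),
        (if U ∈ X then (1 : ℝ) else 0) = ∑ j ∈ range (2 * l + 1 + 1), ((2 * l + 1 - j).factorial : ℝ) * zeta (p j) U) ∧
      ∀ (π : Fin n → Fin n), (∀ x, π (π x) = x) → (∀ x, π x ≠ x) → ∀ e₀ : ℕ,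
        ((X.filter fun U => (U.filter fun x => x < π x ∧ π x ∈ U).card = e₀).card : ℝ) =
          ∑ κ ∈ range (l + 1), ((2 * l + 1 - 2 * κ).factorial : ℝ) *
            ((∑ e' ∈ range (l - κ + 1), if e' ≤ e₀ then
                (-1 : ℝ) ^ (κ - (e₀ - e')) * (κ.choose (e₀ - e') : ℝ) *
                  (((n / 2 - 2 * κ).choose (2 * (l - κ) + 1 - 2 * e' + e') *
                      (2 * (l - κ) + 1 - 2 * e' + e').choose e' * 2 ^ (2 * (l - κ) + 1 - 2 * e') : ℕ) : ℝ)
              else 0) *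
              ∑ T ∈ univ.filter (fun T : Finset (Fin n) => (T.filter fun x => π x ∈ T).card = 2 * κ), p (2 * κ) T) := by
  obtain ⟨p, hp, hdec⟩ := exists_layer_decomposition (by omega) X hX
  refine ⟨p, hp, hdec, fun π hinv hfix e₀ => ?_⟩
  rw [card_filter_level_eq_sum_layers X hX p hdec π e₀]
  -- split the layer sum into even and odd degrees: odd layers vanish, even layers carry the closed-form coefficient
  have hterm : ∀ j ∈ range (2 * l + 1 + 1), ((2 * l + 1 - j).factorial : ℝ) *
      ∑ U ∈ (powersetCard (2 * l + 1) (univ : Finset (Fin n))).filter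
        (fun U => (U.filter fun x => x < π x ∧ π x ∈ U).card = e₀), zeta (p j) U =
      if Even j then ((2 * l + 1 - j).factorial : ℝ) *
        ((∑ e' ∈ range (l - j / 2 + 1), if e' ≤ e₀ then
            (-1 : ℝ) ^ (j / 2 - (e₀ - e')) * ((j / 2).choose (e₀ - e') : ℝ) *
              (((n / 2 - 2 * (j / 2)).choose (2 * (l - j / 2) + 1 - 2 * e' + e') *
                  (2 * (l - j / 2) + 1 - 2 * e' + e').choose e' * 2 ^ (2 * (l - j / 2) + 1 - 2 * e') : ℕ) : ℝ)
          else 0) *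
          ∑ T ∈ univ.filter (fun T : Finset (Fin n) => (T.filter fun x => π x ∈ T).card = 2 * (j / 2)), p (2 * (j / 2)) T)
      else 0 := by
    intro j hj
    rcases Nat.even_or_odd j with ⟨κ, hκ⟩ | hodd
    · have hj2 : j = 2 * κ := by omega
      have hκj : j / 2 = κ := by omega
      rw [if_pos ⟨κ, hκ⟩, hκj]
      have hκl : κ ≤ l := by have := mem_range.1 hj; omega
      rw [hj2, level_column_sum_zeta_eq_difference hinv hfix hκl hl (hp (2 * κ))]
    · rw [if_neg (Nat.not_even_iff_odd.2 hodd),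
        level_column_sum_zeta_eq_zero_of_odd hinv hfix hodd (hp j) l e₀, mul_zero]
  rw [sum_congr rfl hterm, ← sum_filter]
  symm
  refine sum_nbij' (fun κ => 2 * κ) (fun j => j / 2) ?_ ?_ ?_ ?_ ?_
  · intro κ hκ
    simp only [mem_range, mem_filter] at hκ ⊢
    exact ⟨by omega, ⟨κ, by ring⟩⟩
  · intro j hj
    simp only [mem_range, mem_filter] at hj ⊢
    obtain ⟨κ, hκ⟩ := hj.2; omega
  · intro κ _; show 2 * κ / 2 = κ; omega
  · intro j hj
    obtain ⟨κ, hκ⟩ := (mem_filter.1 hj).2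
    show 2 * (j / 2) = j; omega
  · intro κ _; simp only [show 2 * κ / 2 = κ by omega]

end Summit.PneNP.PneNP.Theorems.ChebyshevTracialDesignLevelDifference
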